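/-
Copyright (c) 2026 the pub-hodgecm-mathlib formalisation cell (harness21).  Prover seat hodgecm-mathlib-K2E4-p13 (g0),
Track B «K2-LIT» ∕ h413, ENGINE E4 unit U6 `ArchLimitConstant` — the SIGNED H-step data of the #9 assembly (K2E4-p15's (b), K2E4-p09's ★ `HStepDataSigned`).  2026-09-03.
-/
import Summits.HodgeConjecture.HodgeConjecture.Theorems.K2E4ExplicitArchSingularTransferSignedDefs   -- ★ p855382 (K2E4-p09): `HStepDataSigned` (= ★ `HStepData` + `C_neg : C < 0`)
import Literature.NumberTheory.Automorphic.ArchEndoscopicCentralDescentValueSigned                   -- (this seat) layer 2: `exists_const_tendsto_deriv_two_sin_smul_sum_integral_pi_neg` (`C < 0`)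
import Literature.NumberTheory.Automorphic.ArchEndoscopicDiagonalCongruence                          -- ★ (R3-a): the endoscopic weights `β₂ = (½, −½)` are real of opposite signs at every place
import HarnessLib

/-!
# K2 · E4 · U6: the H-STEP LAW WITH ITS SIGN — `C < 0` at every complex place (the `hHs` input of the signed #9 assembly; Rogawski 1990 §8.2 p. 119 ∕ p. 123, Varadarajan 1989 §6.4 Thm 22)

Cell `pub/hodgecm-mathlib` (D-0151), HCML Track B, crux H413 = `stmt-HodgeConjecture-24833`; prover seat `hodgecm-mathlib-K2E4-p13` (g0), `--supports … --as helper`.  Socket #9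
`sig_K2E4ExplicitArchSingularTransfer` ∕ «signed #9» (K2E4-p15 ★ p855349 `K2E4ArchConstantPhaseSignedOfSignLaw`, ★ `K2E4ArchConstantSignWitness`): the VALUE `cinf = κ·∏_w C_w·2^{|W|} ∕ lam`
of ★ p855083 acquires its PHASE from (a) `0 < κ` (built into ★ (β₀)), **(b) `C_w < 0` at every place — THIS FILE**, (c) the phase of `lam` (K2E4-p11, `GPrimeDataSigned.lam_phase`).

THE MATHEMATICS.  The H-step constant `C_w` of ★ `K2E4ArchHStepLaw.hStepLaw` ∕ ★ `K2E4ArchHStepData.hStepData_nonempty` is Harish-Chandra's constant of the rank-one limit formula on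
`U(β₂)_w ≅ U(1,1)` — born in ★ (R1G) as `C = −2π·C₁(ν)` with `C₁ > 0` (★ (J-sgn) `exists_tendsto_deriv_two_sin_smul_orbitalIntegral_neg`) and carried UNCHANGED through ★ (R1-a)'s mixed
partial reading (layer 1, `ArchRankOneLimitFormulaPartialSigned`) and the `ε`-sheet symmetrisation of the descent (layer 2, `ArchEndoscopicCentralDescentValueSigned`: both sheets at the moving
place give the same limit, `ψ ↦ −ψ` being absorbed by `2 sin ψ`).  So the sign is ONE universal `C_w < 0` (print: «the constant in the limit formula for `H′` differs by a sign from that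
for `H`» — the `H`-block is of `U(1,1)`-type at EVERY complex place).

* **`hStepLaw_neg`** — ★ `K2E4ArchHStepLaw.hStepLaw` VERBATIM with `∃ C : ℝ, C < 0 ∧ …`.
* **`hStepDataSigned_nonempty`** — `Nonempty (HStepDataSigned L νw z w₁)` for Haar `νw`, every `z`, `w₁`: the assembler's signed `hHs := fun νw _ z w₁ => Classical.choice (hStepDataSigned_nonempty …)`.
HONEST LABEL: HC_CM is proved only modulo the 7 printed citations (2 remaining named inputs: hLiu418 = stmt-HodgeConjecture-24832, h413 = stmt-HodgeConjecture-24833) until rung 0 closes; this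
file is sign bookkeeping over ★ bricks and pays no socket by itself.

## References
* [Rogawski1990] J. D. Rogawski, *Automorphic Representations of Unitary Groups in Three Variables*, Ann. of Math. Stud. 123 (1990), §8.2 Prop. 8.2.1 pp. 118–119, p. 123; §14.5
  Lemma 14.5.2 (b)(c) p. 238.
* [Varadarajan1989] V. S. Varadarajan, *An Introduction to Harmonic Analysis on Semisimple Lie Groups* (1989), §6.4 Thm. 22.
-/

set_option autoImplicit false
set_option linter.dupNamespace false  -- the cell's namespace convention `Summit.HodgeConjecture.HodgeConjecture.Cruxes.H413.<File>` repeats the summit = problem name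

noncomputable section

open MeasureTheory NumberField NumberField.InfinitePlace Filter Topology
open scoped MatrixGroups ContDiff Classical
-- the scoped `L^∞`-operator norm on `M_N(L ⊗ ℝ)`, the cell's ambient-smooth convention (★ V1 ∕ ★ (E2))
open scoped Matrix.Norms.Operator

namespace Summit.HodgeConjecture.HodgeConjecture.Cruxes.H413.K2E4ArchHStepDataSigned

open Literature.NumberTheory.Automorphic
open Summit.HodgeConjecture.HodgeConjecture.Cruxes.H413.K2E4ExplicitArchSingularTransferSignedDefs (HStepDataSigned)

/-- **THE H-STEP LAW WITH A NEGATIVE CONSTANT** (★ `K2E4ArchHStepLaw.hStepLaw`'s statement verbatim with `C < 0`): at the endoscopic 2-block weights `β₂ = (½, −½)`, for all orbit σ-algebras,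
Haar measures `νw`, central angles `z` and every place `w₁`, ONE constant `C < 0` with `∂_ψ[2 sin ψ • Σ_ε ∫ Θ d(⊗ M(S, u[w₁ ↦ (z e^{iψ}, z e^{−iψ})], ε))] → C • Σ_ε ∫ Θ d(⊗ M(S ∖ w₁, u, ε))`
along `𝓝[≠] 0` — layer 2 `exists_const_tendsto_deriv_two_sin_smul_sum_integral_pi_neg` at `α := β₂`.
[cite: Rogawski1990, §8.2 Prop. 8.2.1 pp. 118–119; §14.5 Lemma 14.5.2 (b)(c) p. 238] [cite: Varadarajan1989, §6.4 Thm. 22] -/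
theorem hStepLaw_neg (L : Type) [Field L] [NumberField L] [IsCMField L] :
    ∀ [∀ w : {w : InfinitePlace L // IsComplex w}, MeasurableSpace (UnitaryGroup.archLocal L 2 (Matrix.diagonal ![(2 : L)⁻¹, -(2 : L)⁻¹]) w)]
        [∀ w : {w : InfinitePlace L // IsComplex w}, BorelSpace (UnitaryGroup.archLocal L 2 (Matrix.diagonal ![(2 : L)⁻¹, -(2 : L)⁻¹]) w)]
        (νw : ∀ w : {w : InfinitePlace L // IsComplex w}, Measure (UnitaryGroup.archLocal L 2 (Matrix.diagonal ![(2 : L)⁻¹, -(2 : L)⁻¹]) w)) [∀ w, (νw w).IsHaarMeasure]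
        (z : {w : InfinitePlace L // IsComplex w} → Circle) (w₁ : {w : InfinitePlace L // IsComplex w}),
        ∃ C : ℝ, C < 0 ∧ ∀ (Θ : Matrix (Fin 2) (Fin 2) (mixedEmbedding.mixedSpace L) → ℂ), ContDiff ℝ (⊤ : ℕ∞) Θ →
          HasCompactSupport (fun g : UnitaryGroup.arch (↥(maximalRealSubfield L)) L (IsCMField.complexConj L) 2 (Matrix.diagonal ![(2 : L)⁻¹, -(2 : L)⁻¹]) =>
            Θ ((g : GL (Fin 2) (mixedEmbedding.mixedSpace L)) : Matrix (Fin 2) (Fin 2) (mixedEmbedding.mixedSpace L))) →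
          ∀ (S : Finset {w : InfinitePlace L // IsComplex w}), w₁ ∈ S → ∀ (u : {w : InfinitePlace L // IsComplex w} → Fin 2 → Circle), (∀ w ∈ S, w ≠ w₁ → u w 0 ≠ u w 1) →
          Tendsto (fun ψ : ℝ => deriv (fun ψ : ℝ => (2 * Real.sin ψ) • ∑ ε : {w : InfinitePlace L // IsComplex w} → Bool,
              ∫ o, Θ (((((UnitaryGroup.archPiEquivCM 2 L (Matrix.diagonal ![(2 : L)⁻¹, -(2 : L)⁻¹])).symm o) :
                  UnitaryGroup.arch (↥(maximalRealSubfield L)) L (IsCMField.complexConj L) 2 (Matrix.diagonal ![(2 : L)⁻¹, -(2 : L)⁻¹])) : GL (Fin 2) (mixedEmbedding.mixedSpace L)) :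
                  Matrix (Fin 2) (Fin 2) (mixedEmbedding.mixedSpace L))
                ∂(Measure.pi (fun w : {w : InfinitePlace L // IsComplex w} =>
                  if w ∈ S then (νw w).map (fun g : UnitaryGroup.archLocal L 2 (Matrix.diagonal ![(2 : L)⁻¹, -(2 : L)⁻¹]) w =>
                    g * ⟨UnitaryGroup.circleDiagonal 2 (if ε w then (Function.update u w₁ ![z w₁ * Circle.exp ψ, z w₁ * Circle.exp (-ψ)]) w ∘ ⇑(Equiv.swap (0 : Fin 2) 1)
                      else (Function.update u w₁ ![z w₁ * Circle.exp ψ, z w₁ * Circle.exp (-ψ)]) w),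
                      UnitaryGroup.circleDiagonal_mem_archLocal_diagonal L 2 ![(2 : L)⁻¹, -(2 : L)⁻¹] w _⟩ * g⁻¹)
                  else Measure.dirac (⟨UnitaryGroup.circleDiagonal 2 ![z w, z w], UnitaryGroup.circleDiagonal_mem_archLocal_diagonal L 2 ![(2 : L)⁻¹, -(2 : L)⁻¹] w _⟩ :
                    UnitaryGroup.archLocal L 2 (Matrix.diagonal ![(2 : L)⁻¹, -(2 : L)⁻¹]) w)))) ψ)
            (𝓝[≠] 0)
            (𝓝 (C • ∑ ε : {w : InfinitePlace L // IsComplex w} → Bool,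
              ∫ o, Θ (((((UnitaryGroup.archPiEquivCM 2 L (Matrix.diagonal ![(2 : L)⁻¹, -(2 : L)⁻¹])).symm o) :
                  UnitaryGroup.arch (↥(maximalRealSubfield L)) L (IsCMField.complexConj L) 2 (Matrix.diagonal ![(2 : L)⁻¹, -(2 : L)⁻¹])) : GL (Fin 2) (mixedEmbedding.mixedSpace L)) :
                  Matrix (Fin 2) (Fin 2) (mixedEmbedding.mixedSpace L))
                ∂(Measure.pi (fun w : {w : InfinitePlace L // IsComplex w} =>
                  if w ∈ S.erase w₁ then (νw w).map (fun g : UnitaryGroup.archLocal L 2 (Matrix.diagonal ![(2 : L)⁻¹, -(2 : L)⁻¹]) w =>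
                    g * ⟨UnitaryGroup.circleDiagonal 2 (if ε w then u w ∘ ⇑(Equiv.swap (0 : Fin 2) 1) else u w),
                      UnitaryGroup.circleDiagonal_mem_archLocal_diagonal L 2 ![(2 : L)⁻¹, -(2 : L)⁻¹] w _⟩ * g⁻¹)
                  else Measure.dirac (⟨UnitaryGroup.circleDiagonal 2 ![z w, z w], UnitaryGroup.circleDiagonal_mem_archLocal_diagonal L 2 ![(2 : L)⁻¹, -(2 : L)⁻¹] w _⟩ :
                    UnitaryGroup.archLocal L 2 (Matrix.diagonal ![(2 : L)⁻¹, -(2 : L)⁻¹]) w))))) := by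
  intro _ _ νw _ z w₁
  obtain ⟨C, hC, h⟩ := UnitaryGroup.exists_const_tendsto_deriv_two_sin_smul_sum_integral_pi_neg (E := ℂ) L ![(2 : L)⁻¹, -(2 : L)⁻¹] νw z
    (UnitaryGroup.quasiSplitWeightsTwo_ne_zero (L := L)) w₁ (UnitaryGroup.im_embedding_quasiSplitWeightsTwo_eq_zero L w₁) (UnitaryGroup.re_embedding_quasiSplitWeightsTwo_mul_neg L w₁)
  exact ⟨C, hC, fun Θ hΘ hΘc S hw₁ u hu => (h Θ hΘ hΘc S hw₁ u hu).2⟩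

/-- **THE SIGNED H-STEP DATA EXIST at every place** (the signed assembler's `hHs`): for Haar `νw`, central angles `z` and a place `w₁`, `HStepDataSigned L νw z w₁` is inhabited — its
`C < 0` is Harish-Chandra's constant of `hStepLaw_neg`. [cite: Rogawski1990, §8.2 Prop. 8.2.1 pp. 118–119, p. 123] [cite: Varadarajan1989, §6.4 Thm. 22] -/
theorem hStepDataSigned_nonempty (L : Type) [Field L] [NumberField L] [IsCMField L]
    [∀ w : {w : InfinitePlace L // IsComplex w}, MeasurableSpace (UnitaryGroup.archLocal L 2 (Matrix.diagonal ![(2 : L)⁻¹, -(2 : L)⁻¹]) w)]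
    [∀ w : {w : InfinitePlace L // IsComplex w}, BorelSpace (UnitaryGroup.archLocal L 2 (Matrix.diagonal ![(2 : L)⁻¹, -(2 : L)⁻¹]) w)]
    (νw : ∀ w : {w : InfinitePlace L // IsComplex w}, Measure (UnitaryGroup.archLocal L 2 (Matrix.diagonal ![(2 : L)⁻¹, -(2 : L)⁻¹]) w)) [∀ w, (νw w).IsHaarMeasure]
    (z : {w : InfinitePlace L // IsComplex w} → Circle) (w₁ : {w : InfinitePlace L // IsComplex w}) :
    Nonempty (HStepDataSigned L νw z w₁) := by
  obtain ⟨C, hC, h⟩ := hStepLaw_neg L νw z w₁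
  exact ⟨⟨⟨C, hC.ne, h⟩, hC⟩⟩

end Summit.HodgeConjecture.HodgeConjecture.Cruxes.H413.K2E4ArchHStepDataSigned

end
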